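import Literature.AlgebraicGeometry.DuqueFrancoVillaflor2025.JoinQuadraticFundamentalForm
import HarnessLib

/-!
# Duque Franco–Villaflor, Thm. 1.3 (ii): the partial converse "`q` vanishes in degree `e` ⟹ `q_1·ℂ[x]_j` vanishes",
# via Gorenstein duality `(I : (I : P)) = I + (P)` and the socle functional of `R^f ⊗ R^g`

J. Duque Franco, R. Villaflor Loyola, *Periods of join algebraic cycles*, Ann. Sc. Norm. Super. Pisa (2025) =
arXiv:2312.17222 [DuqueFrancoVillaflor2025Join] (held text `paper:arxiv-2312.17222`, v1–v3 numbering; Thm. 1.3 =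
Thm. 4.1 of arXiv v4). Setting as in the tree file `JoinQuadraticFundamentalForm.lean` (which proves eq. (eqQFFjoin)
and (i)): `X = {f(x) + g(y) = 0}`, `J^{f+g,[J(Z_1,Z_2)]} = (J^{f+g} : P_{Z_1}P_{Z_2})`, Maclean's bilinear forms
`q, q_1, q_2` with values in `R^{f+g}/⟨P_{Z_1}P_{Z_2}⟩`, `R^f/⟨P_{Z_1}⟩`, `R^g/⟨P_{Z_2}⟩`. Verbatim (Thm. 1.3):

> In consequence for any degree `e ≥ 0` we have the following: … (ii) If `q` vanishes in degree `e`, then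
> `q_1|_{Sym²(J^{f,[Z_1]}_ℓ)}·ℂ[x]_j = 0 ∈ R^f/⟨P_{Z_1}⟩` for all degrees `ℓ, j ≥ 0` such that `ℓ ≤ e`, `j ≤ 2(e−ℓ)`
> and `2(e−ℓ)−j ≤ (d−2)((n−k)/2)`. One gets a similar assertion for `q_2` by symmetry.
>
> *Proof* (p. 11–12). In order to show (ii) consider `G = H = A(x,y)G_1(x)` for any `ℓ ≤ e` and any
> `G_1 ∈ J^{f,[Z_1]}_ℓ`. Then by (eqQFFjoin) `A²·P_{Z_2}·q_1(G_1,G_1) = 0 ∈ R^{f+g}/⟨P_{Z_1}·P_{Z_2}⟩` for all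
> `A ∈ ℂ[x,y]_{e−ℓ}`. In particular, for any monomial `x^αy^β ∈ ℂ[x,y]_{2(e−ℓ)}` we can write it as `x^αy^β = A_1A_2`
> with `A_1, A_2 ∈ ℂ[x,y]_{e−ℓ}` and so `x^αy^β·P_{Z_2}·q_1(G_1,G_1) = … = 0`. From this, it follows in fact that
> for any `j ≤ 2(e−ℓ)` and any two polynomials `Q(x) ∈ ℂ[x]_j` and `S(y) ∈ ℂ[y]_{2(e−ℓ)−j}`,
> `Q·S·P_{Z_2}·q_1(G_1,G_1) = 0 ∈ R^{f+g}/⟨P_{Z_1}·P_{Z_2}⟩`. As `2(e−ℓ)−j ≤ (d−2)((n−k)/2)` we choose `S` such that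
> `S·P_{Z_2} ∉ J^g`, then there exists some `T(x,y)` … such that (eqq1) `P_{Z_2}(Q(x)·S(y)·q_1(G_1,G_1) − T(x,y)·P_{Z_1})
> ∈ J^{f+g}`. Considering `S_1(y), …, S_t(y)` … a basis … Since `{P_{Z_2}S(y), P_{Z_2}S_{p+1}(y), …, P_{Z_2}S_t(y)}`
> is a basis of `R^g_{2(e−ℓ)+(d−2)((n−k)/2)−j}` and `R^{f+g} = R^f ⊗ R^g`, then (eqq1) is equivalent to have
> `Q(x)·q_1(G_1,G_1) − U(x)·P_{Z_1} = 0 ∈ R^f` and `P_{Z_1}U_h(x) = 0 ∈ R^f` for all `h = p+1, …, t`. Therefore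
> `Q(x)·q_1(G_1,G_1) = 0 ∈ R^f/⟨P_{Z_1}⟩` for all `Q(x) ∈ ℂ[x]_j`. □

## What this file proves (0 facts, 0 sorry), over any field `K`

* §1 **Gorenstein duality** for an Artinian Gorenstein ideal `I = Ann(ℓ)` (tree `IsArtinianGorenstein`, Macaulay's
  functional `ℓ` concentrated in the socle degree) and a form `P`: **`(I : (I : P)) = I + (P)`**
  (`IsArtinianGorenstein.colon_colon_eq_sup_span`; membership forms `mem_annIdeal_sup_span_of_isHomogeneous`,
  `mem_annIdeal_sup_span_of_forall_colon`: if `ℓ(u·w) = 0` for all `w ∈ (I : P)` then `u ∈ I + (P)`). This is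
  `J = Ann Ann J` for the ideal `J = (P̄)` of the Artinian Gorenstein ring `S/I` [Bruns–Herzog, Ex. 3.2.15 (c)]; the
  proof is the perfect pairing `R_a × R_{s−a} → K`: a functional on `S_{s−a}` vanishing on `⋂_h ker ℓ(P h ·)` is of the
  form `ℓ(P m_0 ·)` (Mathlib `FiniteDimensional.mem_span_of_iInf_ker_le_ker`). It replaces the printed basis argument
  ("(eqq1) is equivalent to have `Q·q_1 − U·P_{Z_1} = 0 ∈ R^f`").
* §2 `rename_mul_rename_notMem_sup_span_of_functionals` — the socle-functional witness of `R^{f+g} = R^f ⊗ R^g`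
  (Thm. 1.1, tree `annIdeal_tensorFunctional_of_homogeneousComponent`): if `w_1P_1 ∈ J^f`, `ℓ_f(u w_1) ≠ 0`,
  `ℓ_g(v w_2) ≠ 0` then `u(x)v(y) ∉ J^{f+g} + ⟨P_1(x)P_2(y)⟩` (general-variables form of the tree's
  `rename_mul_rename_notMem_sup_span`).
* §3 `mul_mem_of_forall_mul_mul_mem` ("write `x^αy^β = A_1A_2`": products of forms of degree `a` span degree `2a`),
  `IsArtinianGorenstein.exists_isHomogeneous_mul_notMem` ("choose `S` such that `S·P_{Z_2} ∉ J^g`", possible iff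
  `deg S + deg P_{Z_2} ≤ soc(J^g)`).
* §4 **`mul_macleanForm_mem_of_join_vanishes_in_degree` — Theorem 1.3 (ii)**: for forms `f`, `g` with Artinian
  Gorenstein Jacobian ideals (`f` of degree `d ≥ 2`), forms `P_1` and `P_2 ∉ J^g` of degree `p_2`, and
  `ℓ ≤ e`, `j + t = 2(e−ℓ)`, `t + p_2 ≤ soc(J^g)`: if `q(G,H) ∈ J^{f+g} + ⟨P_1P_2⟩` for all `G, H ∈ (J^{f+g} : P_1P_2)`
  homogeneous of degree `e` and all lifts, then `Q·q_1(G_1,H_1) ∈ J^f + ⟨P_1⟩` for all `G_1, H_1 ∈ (J^f : P_1)`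
  homogeneous of degree `ℓ` (all lifts) and all forms `Q` of degree `j` — the bilinear form of the printed
  `q_1|_{Sym²(J^{f,[Z_1]}_ℓ)}·ℂ[x]_j = 0` (obtained directly from `q(AG_1, BH_1) ≡ ABP_{Z_2}q_1(G_1,H_1)`, so no
  polarization and no hypothesis on the characteristic is needed). With (eqQFFjoin) and (i) in
  `JoinQuadraticFundamentalForm.lean`, the algebraic content of Theorem 1.3 is now complete in the tree.

NOT formalised (cited): Maclean's identification of `q` with the second fundamental form (Thm. 2.1); the residue
dictionary `P_{Z_i}`.

HONEST FRAMING (cell pub-hlocus): certified instances and evidence bearing on the general Hodge conjecture;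
no claim.

## References

* [DuqueFrancoVillaflor2025Join] J. Duque Franco, R. Villaflor Loyola, *Periods of join algebraic cycles*,
  arXiv:2312.17222, Theorem 1.3 (ii) and its proof, pp. 11–12 (= Theorem 4.1 (ii) of arXiv v4), Theorem 1.1.
* [BrunsHerzog1998] W. Bruns, J. Herzog, *Cohen–Macaulay Rings*, CUP, Exercise 3.2.15 (c) (`I = Ann Ann I` in an
  Artinian Gorenstein local ring).
-/

noncomputable section

namespace Literature.AlgebraicGeometry.DuqueFrancoVillaflor2025

open MvPolynomial Finset
open Literature.RingTheory.Koszul Literature.RingTheory.MvPolynomial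
open Literature.AlgebraicGeometry.HodgeTheory
open Literature.AlgebraicGeometry.Kloosterman2025
open Literature.AlgebraicGeometry.DuqueFrancoVillaflor2023 (macleanForm)

universe u v w

variable {K : Type u} [Field K]

/-! ## §1. Gorenstein duality: `(I : (I : P)) = I + (P)` for an Artinian Gorenstein ideal `I` -/

section Duality

variable {σ : Type v} [Fintype σ] {s : ℕ} {ℓ : MvPolynomial σ K →ₗ[K] K}

/-- The functional `w ↦ ℓ(v·w)` on `S_b`, linear in `v`. [folklore] -/
private def mulFunctional (ℓ : MvPolynomial σ K →ₗ[K] K) (b : ℕ) :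
    MvPolynomial σ K →ₗ[K] (homogeneousSubmodule σ K b →ₗ[K] K) where
  toFun v := ℓ ∘ₗ LinearMap.mulLeft K v ∘ₗ (homogeneousSubmodule σ K b).subtype
  map_add' v v' := by
    ext w
    simp [add_mul]
  map_smul' c v := by
    ext w
    simp

omit [Fintype σ] in
/-- Unfolding `mulFunctional`. [folklore] -/
private theorem mulFunctional_apply (ℓ : MvPolynomial σ K →ₗ[K] K) (b : ℕ) (v : MvPolynomial σ K)
    (w : homogeneousSubmodule σ K b) : mulFunctional ℓ b v w = ℓ (v * w) := rfl

attribute [local simp] mulFunctional_apply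

/-- **Gorenstein duality `(I : (I : P)) ⊆ I + (P)`, homogeneous form.** Let `I = Ann(ℓ)` with `ℓ` concentrated in
degree `s` (an Artinian Gorenstein ideal of socle `s`), `P` a form of degree `p` and `u` a form of degree `a`. If
`ℓ(u·w) = 0` for every form `w` of degree `s − a` with `P·w ∈ I`, then `u ∈ I + (P)`. (In the Artinian Gorenstein
ring `R = S/I`: `0 : (0 : P̄) = (P̄)`, i.e. `J = Ann Ann J` for `J = (P̄)`; proof by the perfect pairing
`R_a × R_{s−a} → K`: a functional on `S_{s−a}` vanishing on `⋂_h ker ℓ(P h ·)` is some `ℓ(P m_0 ·)`.) This is the step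
"(eqq1) is equivalent to have `Q(x)·q_1(G_1,G_1) − U(x)·P_{Z_1} = 0 ∈ R^f`" of the proof of Thm. 1.3 (ii).
[cite: BrunsHerzog1998, Exercise 3.2.15 (c)] [cite: DuqueFrancoVillaflor2025Join, Theorem 1.3 (proof of (ii); = Theorem 4.1 of arXiv v4)] -/
theorem mem_annIdeal_sup_span_of_isHomogeneous (hℓ : ∀ q, ℓ (homogeneousComponent s q) = ℓ q)
    {P u : MvPolynomial σ K} {p a : ℕ} (hP : P.IsHomogeneous p) (hu : u.IsHomogeneous a)
    (H : ∀ w : MvPolynomial σ K, w.IsHomogeneous (s - a) → P * w ∈ annIdeal ℓ → ℓ (u * w) = 0) :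
    u ∈ annIdeal ℓ ⊔ Ideal.span {P} := by
  classical
  -- forms of degree `> s` lie in `I`
  rcases lt_or_ge s a with hsa | has
  · exact Ideal.mem_sup_left (mem_annIdeal_of_isHomogeneous_of_lt hℓ hu hsa)
  -- if `a < p` then `(I : P)_{s−a} = S_{s−a}`, so `u ∈ I`
  rcases lt_or_ge a p with hap | hpa
  · refine Ideal.mem_sup_left (mem_annIdeal_of_forall_isHomogeneous hℓ hu (Nat.add_sub_cancel' has) ?_)
    intro w hw
    exact H w hw (mem_annIdeal_of_isHomogeneous_of_lt hℓ (hP.mul hw) (by omega))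
  -- main case `p ≤ a ≤ s`
  haveI : Module.Finite K (homogeneousSubmodule σ K (s - a)) := finite_homogeneousSubmodule (s - a)
  set lam : homogeneousSubmodule σ K (s - a) →ₗ[K] K := mulFunctional ℓ (s - a) u with hlam
  set mu : homogeneousSubmodule σ K (a - p) → (homogeneousSubmodule σ K (s - a) →ₗ[K] K) :=
    fun h => mulFunctional ℓ (s - a) (P * (h : MvPolynomial σ K)) with hmu
  have hker : ⨅ h, LinearMap.ker (mu h) ≤ LinearMap.ker lam := by
    intro w hw
    rw [Submodule.mem_iInf] at hw
    rw [LinearMap.mem_ker, hlam, mulFunctional_apply]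
    refine H _ w.2 (mem_annIdeal_of_forall_isHomogeneous hℓ (hP.mul w.2)
      (show p + (s - a) + (a - p) = s by omega) fun h hh => ?_)
    have h0 := hw ⟨h, hh⟩
    rw [LinearMap.mem_ker, hmu, mulFunctional_apply] at h0
    rw [show P * (w : MvPolynomial σ K) * h = P * h * w by ring]
    exact h0
  have hspan := FiniteDimensional.mem_span_of_iInf_ker_le_ker hker
  -- `span (range mu) = range (mulFunctional ∘ (P·) ∘ subtype)`, so `lam = mu m₀` for a form `m₀` of degree `a − p`
  set M : homogeneousSubmodule σ K (a - p) →ₗ[K] (homogeneousSubmodule σ K (s - a) →ₗ[K] K) :=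
    mulFunctional ℓ (s - a) ∘ₗ LinearMap.mulLeft K P ∘ₗ (homogeneousSubmodule σ K (a - p)).subtype with hM
  have hrange : Submodule.span K (Set.range mu) = LinearMap.range M := by
    have : Set.range mu = Set.range M := by
      ext φ
      simp [hmu, hM]
    rw [this, ← LinearMap.coe_range, Submodule.span_eq]
  rw [hrange] at hspan
  obtain ⟨m₀, hm₀⟩ := hspan
  -- hence `ℓ((u − P m₀) w) = 0` for all forms `w` of degree `s − a`, so `u − P m₀ ∈ I`
  have hkey : ∀ w : MvPolynomial σ K, w.IsHomogeneous (s - a) → ℓ ((u - P * m₀) * w) = 0 := by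
    intro w hw
    have h1 := LinearMap.congr_fun hm₀ ⟨w, hw⟩
    simp only [hM, hlam, LinearMap.coe_comp, Function.comp_apply, Submodule.coe_subtype, LinearMap.mulLeft_apply,
      mulFunctional_apply] at h1
    rw [sub_mul, map_sub, h1, sub_self]
  have hdeg : (u - P * (m₀ : MvPolynomial σ K)).IsHomogeneous a := by
    refine hu.sub ?_
    have := hP.mul m₀.2
    rwa [Nat.add_sub_cancel' hpa] at this
  have hdiff : u - P * (m₀ : MvPolynomial σ K) ∈ annIdeal ℓ :=
    mem_annIdeal_of_forall_isHomogeneous hℓ hdeg (Nat.add_sub_cancel' has) hkey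
  have e : u = (u - P * (m₀ : MvPolynomial σ K)) + (m₀ : MvPolynomial σ K) * P := by ring
  rw [e]
  exact Ideal.add_mem _ (Ideal.mem_sup_left hdiff) (Ideal.mem_sup_right (Ideal.mem_span_singleton'.mpr ⟨_, rfl⟩))

omit [Fintype σ] in
/-- For `ℓ` concentrated in degree `s` and a form `w` of degree `s − i`, `i ≤ s`: `ℓ(u·w)` only sees the degree-`i`
component of `u`. [folklore] -/
private theorem apply_mul_eq_apply_homogeneousComponent_mul (hℓ : ∀ q, ℓ (homogeneousComponent s q) = ℓ q)
    {w : MvPolynomial σ K} {i : ℕ} (hw : w.IsHomogeneous (s - i)) (hi : i ≤ s) (u : MvPolynomial σ K) :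
    ℓ (u * w) = ℓ (homogeneousComponent i u * w) := by
  rw [mul_comm, apply_mul_eq_apply_mul_homogeneousComponent hℓ hw (show s - i + i = s by omega) u, mul_comm]

/-- **Gorenstein duality `(I : (I : P)) = I + (P)`**, membership form for arbitrary `u`: if `I = Ann(ℓ)` (`ℓ`
concentrated in degree `s`), `P` is a form, and `ℓ(u·w) = 0` for all `w ∈ (I : P)`, then `u ∈ I + (P)` (apply the
homogeneous case to each homogeneous component of `u`; `I + (P)` and `(I : P)` are homogeneous ideals).
[cite: BrunsHerzog1998, Exercise 3.2.15 (c)] [cite: DuqueFrancoVillaflor2025Join, Theorem 1.3 (proof of (ii); = Theorem 4.1 of arXiv v4)] -/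
theorem mem_annIdeal_sup_span_of_forall_colon (hℓ : ∀ q, ℓ (homogeneousComponent s q) = ℓ q)
    {P : MvPolynomial σ K} {p : ℕ} (hP : P.IsHomogeneous p) {u : MvPolynomial σ K}
    (H : ∀ w ∈ (annIdeal ℓ).colon {P}, ℓ (u * w) = 0) : u ∈ annIdeal ℓ ⊔ Ideal.span {P} := by
  classical
  rw [← sum_homogeneousComponent u]
  refine Ideal.sum_mem _ fun i _ => ?_
  rcases lt_or_ge s i with hsi | his
  · exact Ideal.mem_sup_left
      (mem_annIdeal_of_isHomogeneous_of_lt hℓ (homogeneousComponent_isHomogeneous i u) hsi)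
  refine mem_annIdeal_sup_span_of_isHomogeneous hℓ hP (homogeneousComponent_isHomogeneous i u) fun w hw hPw => ?_
  rw [← apply_mul_eq_apply_homogeneousComponent_mul hℓ hw his u]
  refine H w ?_
  rw [Submodule.mem_colon_singleton, smul_eq_mul, mul_comm]
  exact hPw

/-- **`(I : (I : P)) = I + (P)` for an Artinian Gorenstein ideal `I` and a form `P`** (`J = Ann Ann J` in the
Artinian Gorenstein ring `S/I`, for `J = (P̄)`). [cite: BrunsHerzog1998, Exercise 3.2.15 (c)]
[cite: DuqueFrancoVillaflor2025Join, Definition 2.1 and Theorem 1.3 (proof of (ii))] -/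
theorem IsArtinianGorenstein.colon_colon_eq_sup_span {I : Ideal (MvPolynomial σ K)} {s : ℕ}
    (hI : IsArtinianGorenstein I s) {P : MvPolynomial σ K} {p : ℕ} (hP : P.IsHomogeneous p) :
    I.colon (I.colon {P} : Set (MvPolynomial σ K)) = I ⊔ Ideal.span {P} := by
  obtain ⟨ℓ, hℓ, -, rfl⟩ := hI.exists_eq_annIdeal
  apply le_antisymm
  · intro u hu
    refine mem_annIdeal_sup_span_of_forall_colon hℓ hP fun w hw => ?_
    have : u * w ∈ annIdeal ℓ := by
      have := Submodule.mem_colon.mp hu w hw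
      rwa [smul_eq_mul] at this
    exact apply_eq_zero_of_mem_annIdeal this
  · refine sup_le (fun u hu => Submodule.mem_colon.mpr fun w _ => ?_) ?_
    · rw [smul_eq_mul]
      exact Ideal.mul_mem_right _ _ hu
    · rw [Ideal.span_le, Set.singleton_subset_iff]
      refine Submodule.mem_colon.mpr fun w hw => ?_
      have hw' : w * P ∈ annIdeal ℓ := by
        have := Submodule.mem_colon_singleton.mp hw
        rwa [smul_eq_mul] at this
      rw [smul_eq_mul, mul_comm]
      exact hw'

end Duality

/-! ## §2. The socle-functional witness of `R^{f+g} = R^f ⊗ R^g` -/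

section Witness

variable {σ : Type v} {τ : Type w} [Fintype σ] [Fintype τ]

omit [Fintype σ] in
/-- **Non-membership in `J^{f+g} + ⟨P_{Z_1}P_{Z_2}⟩` through the socle functional `ℓ_f ⊗ ℓ_g`** (the basis argument
"Since `{P_{Z_2}S(y), P_{Z_2}S_{p+1}(y), …}` is a basis … and `R^{f+g} = R^f ⊗ R^g`, then (eqq1) is equivalent to have
`Q(x)·q_1(G_1,G_1) − U(x)·P_{Z_1} = 0 ∈ R^f`", functional form): let `J^f = Ann(ℓ_1)`, `J^g = Ann(ℓ_2)` with `ℓ_2`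
concentrated in one degree, so `J^{f+g} = Ann(ℓ_1 ⊗ ℓ_2)` (Thm. 1.1). If `w_1P_1 ∈ J^f`, `ℓ_1(u·w_1) ≠ 0` and
`ℓ_2(v·w_2) ≠ 0`, then the functional `(ℓ_1 ⊗ ℓ_2)(· w_1(x)w_2(y))` kills `J^{f+g} + ⟨P_1(x)P_2(y)⟩` but not
`u(x)·v(y)`: hence `u(x)·v(y) ∉ J^{f+g} + ⟨P_1P_2⟩`. (General-variables form of the tree's
`rename_mul_rename_notMem_sup_span`.) [cite: DuqueFrancoVillaflor2025Join, Theorem 1.3 (proof of (ii); = Theorem 4.1 of arXiv v4) and Theorem 1.1] -/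
theorem rename_mul_rename_notMem_sup_span_of_functionals {t₂ : ℕ} {ℓ₁ : MvPolynomial σ K →ₗ[K] K}
    {ℓ₂ : MvPolynomial τ K →ₗ[K] K} (hℓ₂ : ∀ q, ℓ₂ (homogeneousComponent t₂ q) = ℓ₂ q)
    {u P₁ w₁ : MvPolynomial σ K} {v P₂ w₂ : MvPolynomial τ K} (hw₁ : w₁ * P₁ ∈ annIdeal ℓ₁)
    (hu : ℓ₁ (u * w₁) ≠ 0) (hv : ℓ₂ (v * w₂) ≠ 0) :
    rename Sum.inl u * rename Sum.inr v ∉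
      ((annIdeal ℓ₁).map (rename Sum.inl) ⊔ (annIdeal ℓ₂).map (rename Sum.inr) :
          Ideal (MvPolynomial (σ ⊕ τ) K)) ⊔
        Ideal.span {rename Sum.inl P₁ * rename Sum.inr P₂} := by
  set Φ : MvPolynomial (σ ⊕ τ) K →ₗ[K] K :=
    tensorFunctional ℓ₁ ℓ₂ ∘ₗ LinearMap.mulRight K (rename Sum.inl w₁ * rename Sum.inr w₂) with hΦ
  have hAnn : annIdeal (tensorFunctional ℓ₁ ℓ₂) =
      (annIdeal ℓ₁).map (rename Sum.inl) ⊔ (annIdeal ℓ₂).map (rename Sum.inr) :=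
    annIdeal_tensorFunctional_of_homogeneousComponent hℓ₂
  have hkill₁ : ∀ z ∈ ((annIdeal ℓ₁).map (rename Sum.inl) ⊔ (annIdeal ℓ₂).map (rename Sum.inr) :
      Ideal (MvPolynomial (σ ⊕ τ) K)), Φ z = 0 := by
    intro z hz
    rw [← hAnn] at hz
    exact mem_annIdeal_iff.mp hz _
  have hkill₂ : ∀ z ∈ Ideal.span {rename Sum.inl P₁ * rename Sum.inr P₂}, Φ z = 0 := by
    intro z hz
    obtain ⟨r, rfl⟩ := Ideal.mem_span_singleton'.mp hz
    simp only [hΦ, LinearMap.coe_comp, Function.comp_apply, LinearMap.mulRight_apply]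
    have hmem : rename Sum.inl (w₁ * P₁) ∈ annIdeal (tensorFunctional ℓ₁ ℓ₂) := by
      rw [hAnn]
      exact Ideal.mem_sup_left (Ideal.mem_map_of_mem _ hw₁)
    have e : r * (rename Sum.inl P₁ * rename Sum.inr P₂) * (rename Sum.inl w₁ * rename Sum.inr w₂) =
        (r * rename Sum.inr P₂ * rename Sum.inr w₂) * rename Sum.inl (w₁ * P₁) := by
      rw [map_mul]; ring
    rw [e, mul_comm]
    exact apply_eq_zero_of_mem_annIdeal (Ideal.mul_mem_right _ _ hmem)
  have hval : Φ (rename Sum.inl u * rename Sum.inr v) = ℓ₁ (u * w₁) * ℓ₂ (v * w₂) := by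
    simp only [hΦ, LinearMap.coe_comp, Function.comp_apply, LinearMap.mulRight_apply]
    rw [show rename Sum.inl u * rename Sum.inr v * (rename Sum.inl w₁ * rename Sum.inr w₂) =
        rename Sum.inl (u * w₁) * rename (Sum.inr : τ → σ ⊕ τ) (v * w₂) by
      simp only [map_mul]; ring, tensorFunctional_mul_rename]
  intro hmem
  obtain ⟨z₁, hz₁, z₂, hz₂, hsum⟩ := Submodule.mem_sup.mp hmem
  have h0 : Φ (rename Sum.inl u * rename Sum.inr v) = 0 := by
    rw [← hsum, map_add, hkill₁ z₁ hz₁, hkill₂ z₂ hz₂, add_zero]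
  rw [hval] at h0
  exact mul_ne_zero hu hv h0

end Witness

/-! ## §3. Monomials: splitting, and a form `S` of prescribed degree with `S·P ∉ I` -/

section Monomials

variable {σ : Type v}

/-- A monomial in the support of a form of degree `n` has degree `n`. [folklore] -/
private theorem degree_eq_of_mem_support' {p : MvPolynomial σ K} {n : ℕ} (hp : p.IsHomogeneous n)
    {m : σ →₀ ℕ} (hm : m ∈ p.support) : m.degree = n := by
  have := hp (mem_support_iff.mp hm)
  rwa [Finsupp.degree_eq_weight_one]

/-- **Splitting an exponent vector**: one of degree `≥ a` dominates one of degree exactly `a`. [folklore] -/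
private theorem exists_le_degree_eq' (m : σ →₀ ℕ) :
    ∀ a : ℕ, a ≤ m.degree → ∃ m₁ : σ →₀ ℕ, m₁ ≤ m ∧ m₁.degree = a
  | 0, _ => ⟨0, bot_le, by simp⟩
  | a + 1, ha => by
    classical
    obtain ⟨m₁, hle, hdeg⟩ := exists_le_degree_eq' m a (by omega)
    have hne : m₁ ≠ m := by rintro rfl; omega
    obtain ⟨i, hi⟩ : ∃ i, m₁ i < m i := by
      by_contra hcon
      push Not at hcon
      exact hne (le_antisymm hle fun i => hcon i)
    refine ⟨m₁ + Finsupp.single i 1, fun j => ?_, by rw [map_add, hdeg, Finsupp.degree_single]⟩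
    by_cases hj : j = i
    · subst hj
      simp only [Finsupp.coe_add, Pi.add_apply, Finsupp.single_eq_same]
      omega
    · simp only [Finsupp.coe_add, Pi.add_apply, Finsupp.single_eq_of_ne hj, add_zero]
      exact hle j

/-- **A monomial of degree `a + b` is the product of monomials of degrees `a` and `b`.** [folklore] -/
private theorem exists_monomial_eq_mul {m : σ →₀ ℕ} {a b : ℕ} (hm : m.degree = a + b) :
    ∃ m₁ m₂ : σ →₀ ℕ, m₁.degree = a ∧ m₂.degree = b ∧
      (monomial m (1 : K)) = monomial m₁ 1 * monomial m₂ 1 := by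
  obtain ⟨m₁, hle, hm₁⟩ := exists_le_degree_eq' m a (by omega)
  refine ⟨m₁, m - m₁, hm₁, ?_, ?_⟩
  · have h := congrArg Finsupp.degree (add_tsub_cancel_of_le hle)
    rw [map_add, hm₁, hm] at h
    omega
  · rw [monomial_mul, mul_one, add_tsub_cancel_of_le hle]

/-- **Products `A·B` of forms of degree `a` span the forms of degree `2a`**: if a submodule-like predicate closed
under sums holds for all `A·B·T` with `A, B` forms of degree `a`, it holds for `C·T`, `C` any form of degree
`a + a` ("we can write `x^αy^β = A_1A_2` with `A_1, A_2 ∈ ℂ[x,y]_{e−ℓ}`"). [cite: DuqueFrancoVillaflor2025Join, Theorem 1.3 (proof of (ii))] -/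
theorem mul_mem_of_forall_mul_mul_mem {I : Ideal (MvPolynomial σ K)} {a : ℕ} {T : MvPolynomial σ K}
    (h : ∀ A B : MvPolynomial σ K, A.IsHomogeneous a → B.IsHomogeneous a → A * B * T ∈ I)
    {C : MvPolynomial σ K} (hC : C.IsHomogeneous (a + a)) : C * T ∈ I := by
  classical
  rw [C.as_sum, Finset.sum_mul]
  refine Ideal.sum_mem _ fun m hm => ?_
  obtain ⟨m₁, m₂, hm₁, hm₂, hmm⟩ := exists_monomial_eq_mul (K := K) (degree_eq_of_mem_support' hC hm)
  have e : monomial m (coeff m C) = (MvPolynomial.C (coeff m C) * monomial m₁ 1) * monomial m₂ 1 := by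
    rw [mul_assoc, ← hmm, C_mul_monomial, mul_one]
  rw [e]
  refine h _ _ ?_ (isHomogeneous_monomial _ (by rw [hm₂]))
  simpa using (isHomogeneous_C σ (coeff m C)).mul (isHomogeneous_monomial (R := K) (1 : K) (by rw [hm₁]) : (monomial m₁ (1:K)).IsHomogeneous a)

variable [Finite σ]

/-- **A form `S` of degree `t` with `S·P ∉ I`** exists whenever `I` is Artinian Gorenstein of socle `s`, `P ∉ I` is
a form of degree `p` and `t + p ≤ s` ("As `2(e−ℓ)−j ≤ (d−2)((n−k)/2)` we choose `S` such that `S·P_{Z_2} ∉ J^g`"):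
by nondegeneracy there is a form `h` of degree `s − p` with `P·h ∉ I`, hence such a monomial, and a degree-`t`
factor of it. [cite: DuqueFrancoVillaflor2025Join, Theorem 1.3 (proof of (ii); = Theorem 4.1 of arXiv v4)] -/
theorem IsArtinianGorenstein.exists_isHomogeneous_mul_notMem {I : Ideal (MvPolynomial σ K)} {s : ℕ}
    (hI : IsArtinianGorenstein I s) {P : MvPolynomial σ K} {p : ℕ} (hP : P.IsHomogeneous p) (hPI : P ∉ I)
    {t : ℕ} (ht : t + p ≤ s) : ∃ S : MvPolynomial σ K, S.IsHomogeneous t ∧ S * P ∉ I := by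
  classical
  -- a form `h` of degree `s − p` with `P h ∉ I`
  have hex : ∃ h : MvPolynomial σ K, h.IsHomogeneous (s - p) ∧ P * h ∉ I := by
    by_contra hcon
    push Not at hcon
    exact hPI (hI.mem_of_forall_mul_mem' (show p + (s - p) = s by omega) hP hcon)
  obtain ⟨h, hh, hPh⟩ := hex
  -- hence a monomial `x^m` of degree `s − p` with `P x^m ∉ I`
  have hex' : ∃ m ∈ h.support, P * monomial m (1 : K) ∉ I := by
    by_contra hcon
    push Not at hcon
    apply hPh
    rw [h.as_sum, Finset.mul_sum]
    refine Ideal.sum_mem _ fun m hm => ?_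
    rw [show monomial m (coeff m h) = MvPolynomial.C (coeff m h) * monomial m 1 by rw [C_mul_monomial, mul_one],
      mul_left_comm]
    exact Ideal.mul_mem_left _ _ (hcon m hm)
  obtain ⟨m, hm, hPm⟩ := hex'
  have hmdeg : m.degree = t + (s - p - t) := by rw [degree_eq_of_mem_support' hh hm]; omega
  obtain ⟨m₁, m₂, hm₁, hm₂, hmm⟩ := exists_monomial_eq_mul (K := K) hmdeg
  refine ⟨monomial m₁ 1, isHomogeneous_monomial _ (by rw [hm₁]), fun hmem => hPm ?_⟩
  rw [hmm, show P * (monomial m₁ 1 * monomial m₂ 1) = monomial m₂ (1 : K) * (monomial m₁ 1 * P) by ring]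
  exact Ideal.mul_mem_left _ _ hmem

end Monomials

/-! ## §4. Theorem 1.3 (ii): if `q` vanishes in degree `e`, then `q_1|_{Sym²(J^{f,[Z_1]}_ℓ)}·K[x]_j ≡ 0` -/

section PartialConverse

variable {σ : Type v} {τ : Type w} [Fintype σ] [Fintype τ] {f : MvPolynomial σ K} {g : MvPolynomial τ K}

/-- **Theorem 1.3 (ii) [= Thm. 4.1 (ii) of arXiv v4]** — "If `q` vanishes in degree `e`, then
`q_1|_{Sym²(J^{f,[Z_1]}_ℓ)}·ℂ[x]_j = 0 ∈ R^f/⟨P_{Z_1}⟩` for all degrees `ℓ, j ≥ 0` such that `ℓ ≤ e`, `j ≤ 2(e−ℓ)` and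
`2(e−ℓ)−j ≤ (d−2)((n−k)/2)`" — at the level of polynomials, for forms `f ∈ K[x]`, `g ∈ K[y]` of degree `d ≥ 2` with
Artinian Gorenstein Jacobian ideals (socles `s_1`, `s_2`), `P_1 = P_{Z_1}` a form, `P_2 = P_{Z_2} ∉ J^g` a form of degree
`p_2`, and `j + t = 2(e−ℓ)` with `t + p_2 ≤ s_2` (the printed `2(e−ℓ)−j ≤ (d−2)((n−k)/2) = soc(J^g) − deg P_{Z_2}`):
IF `q(G,H) ∈ J^{f+g} + ⟨P_1P_2⟩` for all `G, H ∈ (J^{f+g} : P_1P_2)` homogeneous of degree `e` and all their lifts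
("`q` vanishes in degree `e`"), THEN for all `G_1, H_1 ∈ (J^f : P_1)` homogeneous of degree `ℓ` (any lifts) and every
form `Q` of degree `j`, `Q·q_1(G_1,H_1) ∈ J^f + ⟨P_1⟩`. The bilinear version (`G_1 ≠ H_1` allowed) is proved directly from
`q(A G_1, B H_1) ≡ A B P_{Z_2} q_1(G_1,H_1)` (no polarization needed). Proof as printed: all `A·B·P_2·q_1` with
`deg A = deg B = e − ℓ` vanish, hence `Q(x)S(y)·P_2·q_1` for all `Q ∈ K[x]_j`, `S ∈ K[y]_t`; choose `S` with `S P_2 ∉ J^g`;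
then the socle functional `ℓ_f(·w_1) ⊗ ℓ_g(·w_2)` and Gorenstein duality `(J^f : (J^f : P_1)) = J^f + (P_1)` give
`Q·q_1 ∈ J^f + ⟨P_1⟩`. [cite: DuqueFrancoVillaflor2025Join, Theorem 1.3 (ii) (= Theorem 4.1 (ii) of arXiv v4)] -/
theorem mul_macleanForm_mem_of_join_vanishes_in_degree {d s₁ s₂ : ℕ} (hf : f.IsHomogeneous d) (hd : 2 ≤ d) (hJf : IsArtinianGorenstein (Ideal.span (Set.range fun i => pderiv i f)) s₁)
    (hJg : IsArtinianGorenstein (Ideal.span (Set.range fun j => pderiv j g)) s₂)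
    {P₁ : MvPolynomial σ K} {P₂ : MvPolynomial τ K} {p₁ p₂ : ℕ} (hP₁ : P₁.IsHomogeneous p₁)
    (hP₂ : P₂.IsHomogeneous p₂) (hP₂J : P₂ ∉ Ideal.span (Set.range fun j => pderiv j g))
    {e ℓ j t : ℕ} (hℓe : ℓ ≤ e) (hjt : j + t = 2 * (e - ℓ)) (ht : t + p₂ ≤ s₂)
    (hq : ∀ G H : MvPolynomial (σ ⊕ τ) K, G.IsHomogeneous e → H.IsHomogeneous e →
      G ∈ (Ideal.span (Set.range fun z => pderiv z (joinPoly f g))).colon {rename Sum.inl P₁ * rename Sum.inr P₂} →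
      H ∈ (Ideal.span (Set.range fun z => pderiv z (joinPoly f g))).colon {rename Sum.inl P₁ * rename Sum.inr P₂} →
      ∀ 𝒬 ℛ : σ ⊕ τ → MvPolynomial (σ ⊕ τ) K,
        G * (rename Sum.inl P₁ * rename Sum.inr P₂) = ∑ z, 𝒬 z * pderiv z (joinPoly f g) →
        H * (rename Sum.inl P₁ * rename Sum.inr P₂) = ∑ z, ℛ z * pderiv z (joinPoly f g) →
          macleanForm G H 𝒬 ℛ ∈ Ideal.span (Set.range fun z => pderiv z (joinPoly f g)) ⊔
            Ideal.span {rename Sum.inl P₁ * rename Sum.inr P₂})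
    {G₁ H₁ : MvPolynomial σ K} (hG₁ : G₁.IsHomogeneous ℓ) (hH₁ : H₁.IsHomogeneous ℓ)
    {Q₁ R₁ : σ → MvPolynomial σ K} (hQ₁ : G₁ * P₁ = ∑ i, Q₁ i * pderiv i f)
    (hR₁ : H₁ * P₁ = ∑ i, R₁ i * pderiv i f) {Q : MvPolynomial σ K} (hQ : Q.IsHomogeneous j) :
    Q * macleanForm G₁ H₁ Q₁ R₁ ∈ Ideal.span (Set.range fun i => pderiv i f) ⊔ Ideal.span {P₁} := by
  classical
  set Jf := Ideal.span (Set.range fun i => pderiv i f) with hJfdef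
  set Jg := Ideal.span (Set.range fun j => pderiv j g) with hJgdef
  set JF := Ideal.span (Set.range fun z => pderiv z (joinPoly f g)) with hJFdef
  set P : MvPolynomial (σ ⊕ τ) K := rename Sum.inl P₁ * rename Sum.inr P₂ with hPdef
  set q₁ := macleanForm G₁ H₁ Q₁ R₁ with hq₁def
  have hK₁ : HasKoszulSyzygies fun i => pderiv i f := hasKoszulSyzygies_pderiv_of_isArtinianGorenstein hf hd hJf
  -- (★) `A·B·P₂·q₁ ∈ J^F + ⟨P⟩` for all forms `A, B` of degree `e − ℓ`
  have hstar : ∀ A B : MvPolynomial (σ ⊕ τ) K, A.IsHomogeneous (e - ℓ) → B.IsHomogeneous (e - ℓ) →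
      A * B * (rename Sum.inr P₂ * rename Sum.inl q₁) ∈ JF ⊔ Ideal.span {P} := by
    intro A B hA hB
    have hmemG : ∀ {C : MvPolynomial (σ ⊕ τ) K} {X₁ : MvPolynomial σ K} {L : σ → MvPolynomial σ K},
        X₁ * P₁ = ∑ i, L i * pderiv i f → C * rename Sum.inl X₁ ∈ JF.colon {P} := by
      intro C X₁ L hL
      rw [Submodule.mem_colon_singleton, smul_eq_mul, hPdef, mul_eq_sum_liftInl hL P₂ C]
      exact Ideal.sum_mem _ fun z _ => Ideal.mul_mem_left _ _ (Ideal.subset_span ⟨z, rfl⟩)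
    have hdegG : ∀ {C : MvPolynomial (σ ⊕ τ) K} {X₁ : MvPolynomial σ K}, C.IsHomogeneous (e - ℓ) →
        X₁.IsHomogeneous ℓ → (C * rename Sum.inl X₁).IsHomogeneous e := by
      intro C X₁ hC hX₁
      have := hC.mul (hX₁.rename_isHomogeneous (f := (Sum.inl : σ → σ ⊕ τ)))
      rwa [Nat.sub_add_cancel hℓe] at this
    have h1 := hq _ _ (hdegG hA hG₁) (hdegG hB hH₁) (hmemG hQ₁) (hmemG hR₁) _ _
      (mul_eq_sum_liftInl hQ₁ P₂ A) (mul_eq_sum_liftInl hR₁ P₂ B)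
    have h2 := macleanForm_inl_inl_sub_mem (g := g) (fun i => sub_mem_span_pderiv_of_lifts hK₁ hQ₁ hR₁ i) P₂ A B
    have e : A * B * (rename Sum.inr P₂ * rename Sum.inl q₁) =
        macleanForm (A * rename Sum.inl G₁) (B * rename Sum.inl H₁) (liftInl P₂ A Q₁) (liftInl P₂ B R₁) -
          (macleanForm (A * rename Sum.inl G₁) (B * rename Sum.inl H₁) (liftInl P₂ A Q₁) (liftInl P₂ B R₁) -
            A * B * rename Sum.inr P₂ * rename Sum.inl (macleanForm G₁ H₁ Q₁ R₁)) := by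
      rw [hq₁def]; ring
    rw [e]
    exact Ideal.sub_mem _ h1 (Ideal.mem_sup_left h2)
  -- a form `S` of degree `t` with `S P₂ ∉ J^g`
  obtain ⟨S, hS, hSP⟩ := hJg.exists_isHomogeneous_mul_notMem hP₂ hP₂J ht
  -- (★★) `(Q q₁)(x) · (S P₂)(y) ∈ J^F + ⟨P⟩`
  have h3 : rename Sum.inl (Q * q₁) * rename Sum.inr (S * P₂) ∈ JF ⊔ Ideal.span {P} := by
    have hC : (rename Sum.inl Q * rename Sum.inr S : MvPolynomial (σ ⊕ τ) K).IsHomogeneous ((e - ℓ) + (e - ℓ)) := by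
      have := (hQ.rename_isHomogeneous (f := (Sum.inl : σ → σ ⊕ τ))).mul
        (hS.rename_isHomogeneous (f := (Sum.inr : τ → σ ⊕ τ)))
      rwa [hjt, two_mul] at this
    have h := mul_mem_of_forall_mul_mul_mem hstar hC
    have e : rename Sum.inl (Q * q₁) * rename Sum.inr (S * P₂) =
        rename Sum.inl Q * rename Sum.inr S * (rename Sum.inr P₂ * rename (Sum.inl : σ → σ ⊕ τ) q₁) := by
      simp only [map_mul]; ring
    rw [e]
    exact h
  -- Macaulay functionals
  obtain ⟨ℓf, hℓf, -, hJfeq⟩ := hJf.exists_eq_annIdeal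
  obtain ⟨ℓg, hℓg, -, hJgeq⟩ := hJg.exists_eq_annIdeal
  -- `S P₂ ∉ Ann(ℓ_g)`: a witness `w₂`
  have hw₂ : ∃ w₂ : MvPolynomial τ K, ℓg (S * P₂ * w₂) ≠ 0 := by
    by_contra hcon
    push Not at hcon
    exact hSP (by rw [hJgeq]; exact fun w => hcon w)
  obtain ⟨w₂, hw₂⟩ := hw₂
  -- `ℓ_f(Q q₁ · w₁) = 0` for every `w₁ ∈ (J^f : P₁)` — else the witness functional contradicts (★★)
  have hcol : ∀ w₁ ∈ (annIdeal ℓf).colon {P₁}, ℓf (Q * q₁ * w₁) = 0 := by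
    intro w₁ hw₁
    by_contra hne
    have hw₁' : w₁ * P₁ ∈ annIdeal ℓf := by
      rw [Submodule.mem_colon_singleton, smul_eq_mul] at hw₁
      exact hw₁
    have hnot := rename_mul_rename_notMem_sup_span_of_functionals (P₂ := P₂) hℓg hw₁' hne hw₂
    apply hnot
    rw [← hJfeq, ← hJgeq, ← span_pderiv_joinPoly]
    exact h3
  rw [hJfeq]
  exact mem_annIdeal_sup_span_of_forall_colon hℓf hP₁ hcol

end PartialConverse

end Literature.AlgebraicGeometry.DuqueFrancoVillaflor2025

end
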